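import Summits.KontsevichZagierPeriods.KontsevichZagierPeriods.Theorems.TerasomaMultiplicationBetaCancellationStubTameFormAux4
import Summits.KontsevichZagierPeriods.KontsevichZagierPeriods.Theorems.TerasomaMultiplicationBetaCancellationStubTameFormAux6

/-!
# `BetaCancellation` (stmt-KontsevichZagierPeriods-13633), line `divisor-slicing-transshipment` — stub `stub_tameForm`, auxiliary file 7: the `K₀`-shadow is an additive subgroup

The formal combinations with vanishing `K₀`-shadow (`Shadow c` of `…DivisorSlicingDefs`) form an
additive subgroup of `KZ.FormalRep`: `0` has vanishing shadow (empty presentation); shadows add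
(concatenate the presentations, stabilise both isomorphisms to the larger dimension, juxtapose);
the shadow of `−c` is the inverse isomorphism (`MIso.symm`, the densities being positive on the
slots). Consequently (`shadow_of_mem_relations`) every element of `KZ.relations` has vanishing
shadow as soon as the four move sets do.

References: M. Kontsevich, D. Zagier, *Periods* (2001), §1.2; crux NOTES c6 (F13).
-/

noncomputable section

-- `Summit.KontsevichZagierPeriods.KontsevichZagierPeriods.…` is the tree's mandated layout (single-conjunct summit).
set_option linter.dupNamespace false

namespace Summit.KontsevichZagierPeriods.KontsevichZagierPeriods.BetaCancellationDivisorSlicing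

open MeasureTheory Set Function
open Literature.NumberTheory.Transcendental
open Literature.NumberTheory.Transcendental.KZ
open Literature.ModelTheory.ExponentialFields (IsSemialgebraic isSemialgebraic_univ)

/-! ### Lifts -/

section Lift

variable {n N N' : ℕ}

/-- Stabilising a lift gives the lift to the larger dimension (sets). [folklore] -/
theorem stabSet_liftSet (hn : n ≤ N) (h : N ≤ N') (s : Set (Fin n → ℝ)) :
    stabSet h (liftSet N s) = liftSet N' s := by
  rw [liftSet_eq hn, liftSet_eq (hn.trans h), stabSet_stabSet]

/-- Stabilising a lift gives the lift to the larger dimension (functions). [folklore] -/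
theorem stabFun_liftFun (hn : n ≤ N) (h : N ≤ N') (f : (Fin n → ℝ) → ℝ) :
    stabFun h (liftFun N f) = liftFun N' f := by
  rw [liftFun_eq hn, liftFun_eq (hn.trans h), stabFun_stabFun]

/-- The lifted integrand is positive on the lifted positive part. [folklore] -/
theorem liftFun_pos_of_mem_liftSet_posSet (hn : n ≤ N) (r : IntegralRep n) {z : Fin N → ℝ}
    (hz : z ∈ liftSet N (posSet r)) : 0 < liftFun N r.integrand z := by
  rw [liftSet_eq hn] at hz
  rw [liftFun_eq hn]
  exact stabFun_pos_of_mem hn r hz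

/-- The negated lifted integrand is positive on the lifted negative part. [folklore] -/
theorem liftFun_neg_pos_of_mem_liftSet_negSet (hn : n ≤ N) (r : IntegralRep n) {z : Fin N → ℝ}
    (hz : z ∈ liftSet N (negSet r)) : 0 < liftFun N (-r.integrand) z := by
  rw [liftSet_eq hn] at hz
  rw [liftFun_eq hn]
  exact stabFun_neg_pos_of_mem hn r hz

/-- Lifted positive parts are `ℚ`-semialgebraic. [cite: BCR1998, §2.1] -/
theorem isSemialgebraic_liftSet (N : ℕ) {s : Set (Fin n → ℝ)} (hs : IsSemialgebraic ℚ s) :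
    IsSemialgebraic ℚ (liftSet N s) := by
  by_cases h : n ≤ N
  · rw [liftSet_eq h]
    exact isSemialgebraic_stabSet h hs
  · rw [liftSet, dif_neg h]
    exact Literature.ModelTheory.ExponentialFields.isSemialgebraic_empty

end Lift

namespace Shadow

/-! ### The slots of a shadow have positive densities and are semialgebraic -/

/-- The source densities of a shadow are positive on the source slots. [folklore] -/
theorem src_pos {c : FormalRep} (S : Shadow c) :
    ∀ i, ∀ z ∈ Sum.elim (fun i => liftSet S.N (posSet (S.u i).2))
      (fun j => liftSet S.N (negSet (S.v j).2)) i,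
      0 < Sum.elim (fun i => liftFun S.N (S.u i).2.integrand)
        (fun j => liftFun S.N (-(S.v j).2.integrand)) i z := by
  rintro (i | j) z hz
  · exact liftFun_pos_of_mem_liftSet_posSet (S.hu i) _ hz
  · exact liftFun_neg_pos_of_mem_liftSet_negSet (S.hv j) _ hz

/-- The target densities of a shadow are positive on the target slots. [folklore] -/
theorem tgt_pos {c : FormalRep} (S : Shadow c) :
    ∀ k, ∀ z ∈ Sum.elim (fun j => liftSet S.N (posSet (S.v j).2))
      (fun i => liftSet S.N (negSet (S.u i).2)) k,
      0 < Sum.elim (fun j => liftFun S.N (S.v j).2.integrand)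
        (fun i => liftFun S.N (-(S.u i).2.integrand)) k z := by
  rintro (j | i) z hz
  · exact liftFun_pos_of_mem_liftSet_posSet (S.hv j) _ hz
  · exact liftFun_neg_pos_of_mem_liftSet_negSet (S.hu i) _ hz

/-- The source slots of a shadow are `ℚ`-semialgebraic. [cite: BCR1998, §2.1] -/
theorem src_isSemialgebraic {c : FormalRep} (S : Shadow c) :
    ∀ i, IsSemialgebraic ℚ (Sum.elim (fun i => liftSet S.N (posSet (S.u i).2))
      (fun j => liftSet S.N (negSet (S.v j).2)) i) := by
  rintro (i | j)
  · exact isSemialgebraic_liftSet _ (isSemialgebraic_posSet _)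
  · exact isSemialgebraic_liftSet _ (isSemialgebraic_negSet _)

/-- The target slots of a shadow are `ℚ`-semialgebraic. [cite: BCR1998, §2.1] -/
theorem tgt_isSemialgebraic {c : FormalRep} (S : Shadow c) :
    ∀ k, IsSemialgebraic ℚ (Sum.elim (fun j => liftSet S.N (posSet (S.v j).2))
      (fun i => liftSet S.N (negSet (S.u i).2)) k) := by
  rintro (j | i)
  · exact isSemialgebraic_liftSet _ (isSemialgebraic_posSet _)
  · exact isSemialgebraic_liftSet _ (isSemialgebraic_negSet _)

/-! ### Zero, transport, negation -/

/-- `0` has vanishing shadow (the empty presentation). [folklore] -/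
theorem zero : Nonempty (Shadow 0) := by
  obtain ⟨m⟩ := MIso.of_fintype (N := 0) (ι := Fin 0 ⊕ Fin 0) (κ := Fin 0 ⊕ Fin 0)
    (σ := Sum.elim (fun i => liftSet 0 (posSet (Fin.elim0 i : Σ n, IntegralRep n).2))
      (fun j => liftSet 0 (negSet (Fin.elim0 j : Σ n, IntegralRep n).2)))
    (ρ := Sum.elim (fun i => liftFun 0 (Fin.elim0 i : Σ n, IntegralRep n).2.integrand)
      (fun j => liftFun 0 (-(Fin.elim0 j : Σ n, IntegralRep n).2.integrand)))
    (τ := Sum.elim (fun j => liftSet 0 (posSet (Fin.elim0 j : Σ n, IntegralRep n).2))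
      (fun i => liftSet 0 (negSet (Fin.elim0 i : Σ n, IntegralRep n).2)))
    (θ := Sum.elim (fun j => liftFun 0 (Fin.elim0 j : Σ n, IntegralRep n).2.integrand)
      (fun i => liftFun 0 (-(Fin.elim0 i : Σ n, IntegralRep n).2.integrand)))
    (P₀ := Empty) Empty.elim Empty.elim Empty.elim Empty.elim Empty.elim
    (fun p => p.elim) (fun p => p.elim) (fun p => p.elim)
    (by rintro (i | i) <;> exact i.elim0) (by rintro (i | i) <;> exact i.elim0)
  exact ⟨⟨0, 0, Fin.elim0, Fin.elim0, by simp, 0, fun i => i.elim0, fun j => j.elim0, m⟩⟩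

/-- Transport of a shadow along an equality. [folklore] -/
theorem congr {c c' : FormalRep} (S : Shadow c) (h : c = c') : Nonempty (Shadow c') :=
  h ▸ ⟨S⟩

/-- The shadow of `−c` is the inverse isomorphism. [folklore] -/
theorem neg {c : FormalRep} (S : Shadow c) : Nonempty (Shadow (-c)) := by
  obtain ⟨m⟩ := S.iso.symm S.src_pos
  obtain ⟨a, b, u, v, eq, N, hu, hv, iso⟩ := S
  subst eq
  exact ⟨⟨b, a, v, u, by abel, N, hv, hu, m⟩⟩

/-! ### Addition -/

/-- The re-slotting equivalence for concatenated presentations. [folklore] -/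
theorem exists_sumEquiv (a₁ a₂ b₁ b₂ : ℕ) :
    ∃ e : Fin (a₁ + a₂) ⊕ Fin (b₁ + b₂) ≃ (Fin a₁ ⊕ Fin b₁) ⊕ (Fin a₂ ⊕ Fin b₂),
      (∀ i, e (Sum.inl (Fin.castAdd a₂ i)) = Sum.inl (Sum.inl i)) ∧
      (∀ i, e (Sum.inl (Fin.natAdd a₁ i)) = Sum.inr (Sum.inl i)) ∧
      (∀ j, e (Sum.inr (Fin.castAdd b₂ j)) = Sum.inl (Sum.inr j)) ∧
      (∀ j, e (Sum.inr (Fin.natAdd b₁ j)) = Sum.inr (Sum.inr j)) := by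
  let toF : Fin (a₁ + a₂) ⊕ Fin (b₁ + b₂) → (Fin a₁ ⊕ Fin b₁) ⊕ (Fin a₂ ⊕ Fin b₂) :=
    Sum.elim (Fin.addCases (fun i => Sum.inl (Sum.inl i)) (fun i => Sum.inr (Sum.inl i)))
      (Fin.addCases (fun j => Sum.inl (Sum.inr j)) (fun j => Sum.inr (Sum.inr j)))
  let invF : (Fin a₁ ⊕ Fin b₁) ⊕ (Fin a₂ ⊕ Fin b₂) → Fin (a₁ + a₂) ⊕ Fin (b₁ + b₂) :=
    Sum.elim (Sum.elim (fun i => Sum.inl (Fin.castAdd a₂ i)) (fun j => Sum.inr (Fin.castAdd b₂ j)))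
      (Sum.elim (fun i => Sum.inl (Fin.natAdd a₁ i)) (fun j => Sum.inr (Fin.natAdd b₁ j)))
  have h1 : ∀ i, toF (Sum.inl (Fin.castAdd a₂ i)) = Sum.inl (Sum.inl i) := fun i => by
    simp only [toF, Sum.elim_inl, Fin.addCases_left]
  have h2 : ∀ i, toF (Sum.inl (Fin.natAdd a₁ i)) = Sum.inr (Sum.inl i) := fun i => by
    simp only [toF, Sum.elim_inl, Fin.addCases_right]
  have h3 : ∀ j, toF (Sum.inr (Fin.castAdd b₂ j)) = Sum.inl (Sum.inr j) := fun j => by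
    simp only [toF, Sum.elim_inr, Fin.addCases_left]
  have h4 : ∀ j, toF (Sum.inr (Fin.natAdd b₁ j)) = Sum.inr (Sum.inr j) := fun j => by
    simp only [toF, Sum.elim_inr, Fin.addCases_right]
  have hl : Function.LeftInverse invF toF := by
    rintro (i | j)
    · refine Fin.addCases (fun i => ?_) (fun i => ?_) i
      · rw [h1]; rfl
      · rw [h2]; rfl
    · refine Fin.addCases (fun j => ?_) (fun j => ?_) j
      · rw [h3]; rfl
      · rw [h4]; rfl
  have hr : Function.RightInverse invF toF := by
    rintro ((i | j) | (i | j))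
    · exact h1 i
    · exact h3 j
    · exact h2 i
    · exact h4 j
  exact ⟨⟨toF, invF, hl, hr⟩, h1, h2, h3, h4⟩

/-- **Shadows add.** [folklore] -/
theorem add {c₁ c₂ : FormalRep} (S₁ : Shadow c₁) (S₂ : Shadow c₂) : Nonempty (Shadow (c₁ + c₂)) := by
  obtain ⟨a₁, b₁, u₁, v₁, eq₁, N₁, hu₁, hv₁, iso₁⟩ := S₁
  obtain ⟨a₂, b₂, u₂, v₂, eq₂, N₂, hu₂, hv₂, iso₂⟩ := S₂
  subst eq₁ eq₂
  -- common dimension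
  set N := max N₁ N₂ with hN
  have h₁ : N₁ ≤ N := le_max_left _ _
  have h₂ : N₂ ≤ N := le_max_right _ _
  obtain ⟨m₁⟩ := iso₁.restab h₁
  obtain ⟨m₂⟩ := iso₂.restab h₂
  obtain ⟨m⟩ := m₁.sum m₂
  obtain ⟨e, he₁, he₂, he₃, he₄⟩ := exists_sumEquiv a₁ a₂ b₁ b₂
  obtain ⟨f, hf₁, hf₂, hf₃, hf₄⟩ := exists_sumEquiv b₁ b₂ a₁ a₂
  obtain ⟨m'⟩ := m.reindex e f
  -- the concatenated presentation
  set u : Fin (a₁ + a₂) → Σ n, IntegralRep n := Fin.append u₁ u₂ with hu_def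
  set v : Fin (b₁ + b₂) → Σ n, IntegralRep n := Fin.append v₁ v₂ with hv_def
  have hul : ∀ i, u (Fin.castAdd a₂ i) = u₁ i := fun i => Fin.append_left _ _ i
  have hur : ∀ i, u (Fin.natAdd a₁ i) = u₂ i := fun i => Fin.append_right _ _ i
  have hvl : ∀ j, v (Fin.castAdd b₂ j) = v₁ j := fun j => Fin.append_left _ _ j
  have hvr : ∀ j, v (Fin.natAdd b₁ j) = v₂ j := fun j => Fin.append_right _ _ j
  have hu : ∀ i, (u i).1 ≤ N := fun i => by
    refine Fin.addCases (fun i => ?_) (fun i => ?_) i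
    · rw [hul]; exact (hu₁ i).trans h₁
    · rw [hur]; exact (hu₂ i).trans h₂
  have hv : ∀ j, (v j).1 ≤ N := fun j => by
    refine Fin.addCases (fun j => ?_) (fun j => ?_) j
    · rw [hvl]; exact (hv₁ j).trans h₁
    · rw [hvr]; exact (hv₂ j).trans h₂
  have heq : (∑ i, of (u₁ i).2 - ∑ j, of (v₁ j).2) + (∑ i, of (u₂ i).2 - ∑ j, of (v₂ j).2) =
      ∑ i, of (u i).2 - ∑ j, of (v j).2 := by
    have e1 : ∑ x : Fin a₁, of (u (Fin.castAdd a₂ x)).2 = ∑ x, of (u₁ x).2 :=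
      Finset.sum_congr rfl fun x _ => by rw [hul]
    have e2 : ∑ x : Fin a₂, of (u (Fin.natAdd a₁ x)).2 = ∑ x, of (u₂ x).2 :=
      Finset.sum_congr rfl fun x _ => by rw [hur]
    have e3 : ∑ x : Fin b₁, of (v (Fin.castAdd b₂ x)).2 = ∑ x, of (v₁ x).2 :=
      Finset.sum_congr rfl fun x _ => by rw [hvl]
    have e4 : ∑ x : Fin b₂, of (v (Fin.natAdd b₁ x)).2 = ∑ x, of (v₂ x).2 :=
      Finset.sum_congr rfl fun x _ => by rw [hvr]
    rw [Fin.sum_univ_add, Fin.sum_univ_add, e1, e2, e3, e4]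
    abel
  refine ⟨⟨_, _, u, v, heq, N, hu, hv, Classical.choice (m'.copy ?_ ?_ ?_ ?_)⟩⟩
  · funext x
    rcases x with i | j
    · refine Fin.addCases (fun i => ?_) (fun i => ?_) i
      · simp only [Sum.elim_inl, Function.comp_apply, he₁, stabSet_liftSet (hu₁ i) h₁]
        rw [hul]
      · simp only [Sum.elim_inl, Sum.elim_inr, Function.comp_apply, he₂,
          stabSet_liftSet (hu₂ i) h₂]
        rw [hur]
    · refine Fin.addCases (fun j => ?_) (fun j => ?_) j
      · simp only [Sum.elim_inl, Sum.elim_inr, Function.comp_apply, he₃,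
          stabSet_liftSet (hv₁ j) h₁]
        rw [hvl]
      · simp only [Sum.elim_inr, Function.comp_apply, he₄, stabSet_liftSet (hv₂ j) h₂]
        rw [hvr]
  · funext x
    rcases x with i | j
    · refine Fin.addCases (fun i => ?_) (fun i => ?_) i
      · simp only [Sum.elim_inl, Function.comp_apply, he₁, stabFun_liftFun (hu₁ i) h₁]
        rw [hul]
      · simp only [Sum.elim_inl, Sum.elim_inr, Function.comp_apply, he₂,
          stabFun_liftFun (hu₂ i) h₂]
        rw [hur]
    · refine Fin.addCases (fun j => ?_) (fun j => ?_) j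
      · simp only [Sum.elim_inl, Sum.elim_inr, Function.comp_apply, he₃,
          stabFun_liftFun (hv₁ j) h₁]
        rw [hvl]
      · simp only [Sum.elim_inr, Function.comp_apply, he₄, stabFun_liftFun (hv₂ j) h₂]
        rw [hvr]
  · funext x
    rcases x with j | i
    · refine Fin.addCases (fun j => ?_) (fun j => ?_) j
      · simp only [Sum.elim_inl, Function.comp_apply, hf₁, stabSet_liftSet (hv₁ j) h₁]
        rw [hvl]
      · simp only [Sum.elim_inl, Sum.elim_inr, Function.comp_apply, hf₂,
          stabSet_liftSet (hv₂ j) h₂]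
        rw [hvr]
    · refine Fin.addCases (fun i => ?_) (fun i => ?_) i
      · simp only [Sum.elim_inl, Sum.elim_inr, Function.comp_apply, hf₃,
          stabSet_liftSet (hu₁ i) h₁]
        rw [hul]
      · simp only [Sum.elim_inr, Function.comp_apply, hf₄, stabSet_liftSet (hu₂ i) h₂]
        rw [hur]
  · funext x
    rcases x with j | i
    · refine Fin.addCases (fun j => ?_) (fun j => ?_) j
      · simp only [Sum.elim_inl, Function.comp_apply, hf₁, stabFun_liftFun (hv₁ j) h₁]
        rw [hvl]
      · simp only [Sum.elim_inl, Sum.elim_inr, Function.comp_apply, hf₂,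
          stabFun_liftFun (hv₂ j) h₂]
        rw [hvr]
    · refine Fin.addCases (fun i => ?_) (fun i => ?_) i
      · simp only [Sum.elim_inl, Sum.elim_inr, Function.comp_apply, hf₃,
          stabFun_liftFun (hu₁ i) h₁]
        rw [hul]
      · simp only [Sum.elim_inr, Function.comp_apply, hf₄, stabFun_liftFun (hu₂ i) h₂]
        rw [hur]

/-- Finite sums of combinations with vanishing shadow have vanishing shadow. [folklore] -/
theorem sum {α : Type*} (s : Finset α) (c : α → FormalRep) (h : ∀ a ∈ s, Nonempty (Shadow (c a))) :
    Nonempty (Shadow (∑ a ∈ s, c a)) := by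
  classical
  induction s using Finset.induction_on with
  | empty => simpa using zero
  | insert a s ha ih =>
    rw [Finset.sum_insert ha]
    obtain ⟨S₁⟩ := h a (Finset.mem_insert_self a s)
    obtain ⟨S₂⟩ := ih fun b hb => h b (Finset.mem_insert_of_mem hb)
    exact S₁.add S₂

/-- Differences. [folklore] -/
theorem sub {c₁ c₂ : FormalRep} (S₁ : Shadow c₁) (S₂ : Shadow c₂) : Nonempty (Shadow (c₁ - c₂)) := by
  obtain ⟨S₂'⟩ := S₂.neg
  obtain ⟨S⟩ := S₁.add S₂'
  exact S.congr (sub_eq_add_neg _ _).symm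

end Shadow

/-! ### The closure -/

/-- **Every relation has vanishing shadow as soon as the four move sets do** (the combinations
with vanishing shadow form an additive subgroup). [folklore] -/
theorem shadow_of_mem_relations
    (hgen : ∀ c ∈ domainAddRel ∪ integrandAddRel ∪ changeOfVariablesRel ∪ newtonLeibnizRel,
      Nonempty (Shadow c)) {c : FormalRep} (hc : c ∈ relations) : Nonempty (Shadow c) := by
  refine AddSubgroup.closure_induction (p := fun c _ => Nonempty (Shadow c)) hgen Shadow.zero
    (fun x y _ _ hx hy => ?_) (fun x _ hx => ?_) hc
  · obtain ⟨Sx⟩ := hx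
    obtain ⟨Sy⟩ := hy
    exact Sx.add Sy
  · obtain ⟨Sx⟩ := hx
    exact Sx.neg

/-! ### Headline -/

/-- Registered helper goal of the stub `stub_tameForm`: the combinations with vanishing `K₀`-shadow
form an additive subgroup, so contain `relations` once they contain the four move sets. [folklore] -/
theorem tameForm_aux_shadowSubgroup : (∀ c ∈ domainAddRel ∪ integrandAddRel ∪ changeOfVariablesRel ∪ newtonLeibnizRel, Nonempty (Shadow c)) → ∀ c ∈ relations, Nonempty (Shadow c) :=
  fun hgen _ hc => shadow_of_mem_relations hgen hc

end Summit.KontsevichZagierPeriods.KontsevichZagierPeriods.BetaCancellationDivisorSlicing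

end
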